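import Mathlib

/-!
# SoloBlind E50 — sign cells: a commutative ring with `2` invertible and two involutions splits into four cells

Solo programme `solo-Langlands-blind`, own line (O1b), s118 (tower theory §13.4/§13.9, claims C433/C434).
On the new part of the weight-2 Hecke ring of level `qN` the operators `U_q`, `U_N` are involutions.  The structural
fact used to read the Eisenstein modulus law cell by cell is: in a commutative ring `R` in which `2` is a unit, two
elements `u, v` with `u² = v² = 1` give four pairwise comaximal ideals `I_(s,t) = (u − s, v − t)`, `s, t ∈ {1, −1}`, with
zero intersection, hence `R ≃+* ∏_(s,t) R ⧸ I_(s,t)` (Chinese remainder theorem).  So after inverting `2` — in particular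
after localising at any odd prime — the Hecke ring is the product of its four sign cells, and the order of any quotient
`R ⧸ J` with `J ⊇` nothing in particular is the product of the four cell contributions.

* `cellNum_kills_fst/snd` : `(u − s)·(1 + s u)(1 + t v) = 0`, `(v − t)·(1 + s u)(1 + t v) = 0`;
* `cellNum_sum`            : the four numerators sum to `4`;
* `eq_zero_of_mem_cells`   : an element lying in all four cell ideals is `0`;
* `cellFamily_iInf`, `cellFamily_isCoprime`, and the ring isomorphism `cellDecomposition`.
-/

set_option linter.dupNamespace false

namespace Summit.Langlands.Langlands.Theorems.SoloBlindSignCells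

variable {R : Type*} [CommRing R]

/-- Numerator of the sign-cell idempotent: `(1 + s u)(1 + t v)` (the idempotent is this divided by `4`). -/
def cellNum (u v s t : R) : R := (1 + s * u) * (1 + t * v)

/-- The sign-cell ideal `(u − s, v − t)`. -/
def cellIdeal (u v s t : R) : Ideal R := Ideal.span {u - s, v - t}

/-- `(u − s)` kills the cell numerator when `u² = 1 = s²`. -/
theorem cellNum_kills_fst (u v s t : R) (hu : u * u = 1) (hs : s * s = 1) :
    (u - s) * cellNum u v s t = 0 := by
  unfold cellNum
  have h : (u - s) * (1 + s * u) = 0 := by linear_combination s * hu - u * hs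
  calc (u - s) * ((1 + s * u) * (1 + t * v)) = ((u - s) * (1 + s * u)) * (1 + t * v) := by ring
    _ = 0 := by rw [h, zero_mul]

/-- `(v − t)` kills the cell numerator when `v² = 1 = t²`. -/
theorem cellNum_kills_snd (u v s t : R) (hv : v * v = 1) (ht : t * t = 1) :
    (v - t) * cellNum u v s t = 0 := by
  unfold cellNum
  have h : (v - t) * (1 + t * v) = 0 := by linear_combination t * hv - v * ht
  calc (v - t) * ((1 + s * u) * (1 + t * v)) = ((v - t) * (1 + t * v)) * (1 + s * u) := by ring
    _ = 0 := by rw [h, zero_mul]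

/-- The four numerators sum to `4`. -/
theorem cellNum_sum (u v : R) :
    cellNum u v 1 1 + cellNum u v 1 (-1) + cellNum u v (-1) 1 + cellNum u v (-1) (-1) = 4 := by
  unfold cellNum; ring

/-- An element of the cell ideal `(u − s, v − t)` is killed by the cell numerator. -/
theorem cellNum_mul_eq_zero_of_mem (u v s t x : R) (hu : u * u = 1) (hv : v * v = 1)
    (hs : s * s = 1) (ht : t * t = 1) (hx : x ∈ cellIdeal u v s t) : cellNum u v s t * x = 0 := by
  unfold cellIdeal at hx
  obtain ⟨a, b, rfl⟩ := Ideal.mem_span_pair.1 hx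
  have h1 := cellNum_kills_fst u v s t hu hs
  have h2 := cellNum_kills_snd u v s t hv ht
  calc cellNum u v s t * (a * (u - s) + b * (v - t))
      = a * ((u - s) * cellNum u v s t) + b * ((v - t) * cellNum u v s t) := by ring
    _ = 0 := by rw [h1, h2]; ring

/-- Zero intersection: an element lying in all four cell ideals vanishes (needs `2` invertible). -/
theorem eq_zero_of_mem_cells (h2 : IsUnit (2 : R)) (u v x : R) (hu : u * u = 1) (hv : v * v = 1)
    (h11 : x ∈ cellIdeal u v 1 1) (h12 : x ∈ cellIdeal u v 1 (-1)) (h21 : x ∈ cellIdeal u v (-1) 1)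
    (h22 : x ∈ cellIdeal u v (-1) (-1)) : x = 0 := by
  have e11 := cellNum_mul_eq_zero_of_mem u v 1 1 x hu hv (by ring) (by ring) h11
  have e12 := cellNum_mul_eq_zero_of_mem u v 1 (-1) x hu hv (by ring) (by ring) h12
  have e21 := cellNum_mul_eq_zero_of_mem u v (-1) 1 x hu hv (by ring) (by ring) h21
  have e22 := cellNum_mul_eq_zero_of_mem u v (-1) (-1) x hu hv (by ring) (by ring) h22
  have hsum := cellNum_sum u v
  have h4 : (4 : R) * x = 0 := by
    rw [← hsum]
    linear_combination e11 + e12 + e21 + e22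
  obtain ⟨w, hw⟩ := h2
  have h4u : IsUnit (4 : R) := by
    have : (4 : R) = 2 * 2 := by norm_num
    rw [this]; exact ⟨w * w, by rw [Units.val_mul, hw]⟩
  obtain ⟨w4, hw4⟩ := h4u
  have : (w4⁻¹ : Rˣ).val * ((4 : R) * x) = 0 := by rw [h4, mul_zero]
  rwa [← mul_assoc, ← hw4, Units.inv_mul, one_mul] at this

/-- Comaximality across the first sign: `(u − 1, v − t) + (u + 1, v − t') = R`. -/
theorem cellIdeal_sup_fst (h2 : IsUnit (2 : R)) (u v t t' : R) :
    cellIdeal u v 1 t ⊔ cellIdeal u v (-1) t' = ⊤ := by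
  apply Ideal.eq_top_of_isUnit_mem _ _ h2
  have ha : u - 1 ∈ cellIdeal u v 1 t := Ideal.subset_span (by simp)
  have hb : u - (-1) ∈ cellIdeal u v (-1) t' := Ideal.subset_span (by simp)
  have : (2 : R) = (u - (-1)) - (u - 1) := by ring
  rw [this]
  exact Ideal.sub_mem _ (Ideal.mem_sup_right hb) (Ideal.mem_sup_left ha)

/-- Comaximality across the second sign: `(u − s, v − 1) + (u − s', v + 1) = R`. -/
theorem cellIdeal_sup_snd (h2 : IsUnit (2 : R)) (u v s s' : R) :
    cellIdeal u v s 1 ⊔ cellIdeal u v s' (-1) = ⊤ := by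
  apply Ideal.eq_top_of_isUnit_mem _ _ h2
  have ha : v - 1 ∈ cellIdeal u v s 1 := Ideal.subset_span (by simp)
  have hb : v - (-1) ∈ cellIdeal u v s' (-1) := Ideal.subset_span (by simp)
  have : (2 : R) = (v - (-1)) - (v - 1) := by ring
  rw [this]
  exact Ideal.sub_mem _ (Ideal.mem_sup_right hb) (Ideal.mem_sup_left ha)

/-- The four cell ideals indexed by `Fin 4`: `(+,+), (+,−), (−,+), (−,−)`. -/
def cellFamily (u v : R) : Fin 4 → Ideal R :=
  ![cellIdeal u v 1 1, cellIdeal u v 1 (-1), cellIdeal u v (-1) 1, cellIdeal u v (-1) (-1)]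

/-- The four cell ideals have zero intersection. -/
theorem cellFamily_iInf (h2 : IsUnit (2 : R)) (u v : R) (hu : u * u = 1) (hv : v * v = 1) :
    ⨅ i, cellFamily u v i = ⊥ := by
  rw [eq_bot_iff]
  intro x hx
  rw [Ideal.mem_iInf] at hx
  have h0 := hx 0; have h1 := hx 1; have h2' := hx 2; have h3 := hx 3
  simp only [cellFamily, Matrix.cons_val_zero, Matrix.cons_val_one] at h0 h1 h2' h3
  exact (Ideal.mem_bot).2 (eq_zero_of_mem_cells h2 u v x hu hv h0 h1 h2' h3)

/-- The four cell ideals are pairwise comaximal. -/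
theorem cellFamily_isCoprime (h2 : IsUnit (2 : R)) (u v : R) :
    Pairwise fun i j => IsCoprime (cellFamily u v i) (cellFamily u v j) := by
  have f1 := cellIdeal_sup_fst h2 u v
  have f2 := cellIdeal_sup_snd h2 u v
  have c01 : cellFamily u v 0 ⊔ cellFamily u v 1 = ⊤ := f2 1 1
  have c02 : cellFamily u v 0 ⊔ cellFamily u v 2 = ⊤ := f1 1 1
  have c03 : cellFamily u v 0 ⊔ cellFamily u v 3 = ⊤ := f1 1 (-1)
  have c12 : cellFamily u v 1 ⊔ cellFamily u v 2 = ⊤ := f1 (-1) 1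
  have c13 : cellFamily u v 1 ⊔ cellFamily u v 3 = ⊤ := f1 (-1) (-1)
  have c23 : cellFamily u v 2 ⊔ cellFamily u v 3 = ⊤ := f2 (-1) (-1)
  intro i j hij
  rw [Ideal.isCoprime_iff_sup_eq]
  fin_cases i <;> fin_cases j
  · exact absurd rfl hij
  · exact c01
  · exact c02
  · exact c03
  · exact (sup_comm _ _).trans c01
  · exact absurd rfl hij
  · exact c12
  · exact c13
  · exact (sup_comm _ _).trans c02
  · exact (sup_comm _ _).trans c12
  · exact absurd rfl hij
  · exact c23
  · exact (sup_comm _ _).trans c03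
  · exact (sup_comm _ _).trans c13
  · exact (sup_comm _ _).trans c23
  · exact absurd rfl hij

/-- SIGN-CELL DECOMPOSITION: with `2` invertible and `u² = v² = 1`, `R` is the product of its four cells. -/
noncomputable def cellDecomposition (h2 : IsUnit (2 : R)) (u v : R) (hu : u * u = 1) (hv : v * v = 1) :
    R ≃+* ((i : Fin 4) → R ⧸ cellFamily u v i) :=
  ((RingEquiv.quotientBot R).symm.trans (Ideal.quotEquivOfEq (cellFamily_iInf h2 u v hu hv).symm)).trans
    (Ideal.quotientInfRingEquivPiQuotient (cellFamily u v) (cellFamily_isCoprime h2 u v))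

end Summit.Langlands.Langlands.Theorems.SoloBlindSignCells
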